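import Summits.Ventures.WeilGRH.TwistedMomentCells
import Literature.NumberTheory.LFunctions.WeilTwoPrimeCells
import HarnessLib

/-!
# Moment-method certificates for TWISTED Weil weights, VII: two-prime cells with SIGNED ripples

Cell `rh-explicit`, WEIL TRACK — GRH ARM (namespace `Summit.Ventures.WeilGRH`).  On the window `2t ≤ log 4`
(and, for `χ(4) = 0`, `2t ≤ log 5`) the twisted form of a Dirichlet character `χ` with REAL `χ(2) = s₂`,
`χ(3) = s₃ ∈ {−1, 0, 1}` has the frequency-side weight (`weilFinitePrimeWeightChar χ 3`)

  `M_{χ,3}(τ) = Re ψ(1/4 + a_χ/2 + iτ/2) + (log q − log π) + s₂·(−√2 log 2 cos(τ log 2)) + s₃·(−(2 log 3/√3) cos(τ log 3))`;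

the `ζ` two-prime weight `w₂₃` (`WeilTwoPrimeQuadratic.lean`) is the case `s₂ = s₃ = 1`, `a = 0`, level `−log π`.
This file is the two-prime analogue of `TwistedMomentCells.lean` (file II): the cell checker for the
**twisted two-prime model weight**

  `twistWeight23 s₂ s₃ τ = twistWeight s₂ τ + s₃·(−(2 log 3/√3) cos(τ log 3))`

on the `ζ` side's data type `TPDCell` (`WeilTwoPrimeCells.lean`, unchanged — the 248 cells of `weilCert23P` are
re-used with re-signed claims):

* `alpha3HiQ`, `beta3HiQ` — engine UPPER bounds of `α₃(u) = −(2 log 3/√3) cos(u log 3)`, `β₃(u) = (2 log 3/√3) sin(u log 3)`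
  (the lower bounds `alpha3LoQ`, `beta3LoQ` are the `ζ` file's), and the signed claim test `TPDCell.checkRipple3S s₃`;
* `TPDCell.checkZS23 s₂ s₃ p j` — the first-prime part by the twisted checker `FPDCell.checkZS s₂ p j`, the prime-`3`
  side conditions of `TPDCell.checkZ`, and `checkRipple3S s₃`; soundness **`TPDCell.sigma_le_ZS23`**
  (`σ ≤ twistWeight23 s₂ s₃` on the cell) and the weight-generic validity record `CellValidW23`
  (`cellValidW23_of_checkZS23`), the two-prime analogue of `CellValidW`;
* `rippleHiQ23 s₂ s₃ = rippleHiQ s₂ + |s₃|·(2 log 3/√3)⁺` and the tail bound `twistWeight23_ge_tail`;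
* `checkCellsZS23 s₂ s₃ p j wL T M cells` — chain from `0` to `T`, every cell `checkZS23`, `|s₂|, |s₃| ≤ 1`, dyadic `T`,
  tail level test `wL + rippleHiQ23 ≤ wLoZ(T)`, with its unpacking lemma and the pointwise tail consequence
  `checkCellsZS23_tail` (`wL ≤ twistWeight23 s₂ s₃ τ` for `|τ| ≥ T`).

The chain predicate over `List TPDCell`, the certificate record and the Dirichlet entry (the analogues of
`TwistedMomentChain/Cert/CertSound/Dirichlet`) are later files.  DATA: exact certificates in this format exist for
`5.4` at `59/100`, `log 2` and for `4.3` at `59/100`, `log 2`, `(log 5)/2` (EXTREMALS/GRH/twisted-2ripple-CERT).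
Everything here is PROVED; no named facts.
-/

noncomputable section

open Complex Finset MeasureTheory Set Filter
open scoped Real Topology BigOperators

namespace Summit.Ventures.WeilGRH

open Literature.NumberTheory.LFunctions
open Literature.Analysis.ValidatedNumerics.Numerics
open Literature.Analysis.SpecialFunctions

/-! ## The twisted two-prime model weight -/

/-- The twisted two-prime model weight
`twistWeight23 s₂ s₃ τ = Re ψ(1/4 + iτ/2) + s₂·(−√2 log 2 cos(τ log 2)) + s₃·(−(2 log 3/√3) cos(τ log 3))`. [folklore] -/
def twistWeight23 (s₂ s₃ : ℤ) (τ : ℝ) : ℝ :=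
  twistWeight s₂ τ + (s₃ : ℝ) * (-(2 * Real.log 3 / Real.sqrt 3 * Real.cos (τ * Real.log 3)))

/-- `twistWeight23 s₂ s₃` is even. [folklore] -/
theorem twistWeight23_neg (s₂ s₃ : ℤ) (τ : ℝ) : twistWeight23 s₂ s₃ (-τ) = twistWeight23 s₂ s₃ τ := by
  unfold twistWeight23
  rw [twistWeight_neg, neg_mul, Real.cos_neg]

/-- `0 ≤ 2 log 3/√3`. [folklore] -/
theorem cThree_nonneg : 0 ≤ 2 * Real.log 3 / Real.sqrt 3 := by
  have : 0 ≤ Real.log 3 := Real.log_nonneg (by norm_num)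
  positivity

/-- Tail bound: for `|τ| ≥ T ≥ 0`,
`Re ψ(1/4 + iT/2) − |s₂| √2 log 2 − |s₃| (2 log 3/√3) ≤ twistWeight23 s₂ s₃ τ`. [folklore] -/
theorem twistWeight23_ge_tail {s₂ s₃ : ℤ} {T τ : ℝ} (hT : 0 ≤ T) (hτ : T ≤ |τ|) :
    reDigammaQuarter T - |(s₂ : ℝ)| * (Real.sqrt 2 * Real.log 2) - |(s₃ : ℝ)| * (2 * Real.log 3 / Real.sqrt 3) ≤
      twistWeight23 s₂ s₃ τ := by
  have h1 := twistWeight_ge_tail (s := s₂) hT hτ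
  have hc0 := cThree_nonneg
  have h2 : |(s₃ : ℝ) * (-(2 * Real.log 3 / Real.sqrt 3 * Real.cos (τ * Real.log 3)))| ≤
      |(s₃ : ℝ)| * (2 * Real.log 3 / Real.sqrt 3) := by
    rw [abs_mul, abs_neg]
    refine mul_le_mul_of_nonneg_left ?_ (abs_nonneg _)
    rw [abs_mul, abs_of_nonneg hc0]
    exact mul_le_of_le_one_right hc0 (Real.abs_cos_le_one _)
  unfold twistWeight23
  linarith [neg_abs_le ((s₃ : ℝ) * (-(2 * Real.log 3 / Real.sqrt 3 * Real.cos (τ * Real.log 3))))]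

/-! ## Engine upper bounds of the prime-3 ripple constants -/

/-- A rational `≥ α₃(u) := −(2 log 3/√3) · cos(u log 3)`. [folklore] -/
def alpha3HiQ (u : ℚ) : ℚ := (FI.neg (FI.mul cThreeFI (FI.cosSin (theta3FI u)).1)).hiQ

/-- A rational `≥ β₃(u) := (2 log 3/√3) · sin(u log 3)`. [folklore] -/
def beta3HiQ (u : ℚ) : ℚ := (FI.mul cThreeFI (FI.cosSin (theta3FI u)).2).hiQ

/-- `−(2 log 3/√3) cos(u log 3) ≤ alpha3HiQ u`. [folklore] -/
theorem le_alpha3HiQ (u : ℚ) :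
    -(2 * Real.log 3 / Real.sqrt 3 * Real.cos ((u : ℝ) * Real.log 3)) ≤ (alpha3HiQ u : ℝ) := by
  have h := (FI.mem_cosSin (mem_theta3FI u)).1
  exact FI.le_hiQ (FI.mem_neg (FI.mem_mul mem_cThreeFI h))

/-- `(2 log 3/√3) sin(u log 3) ≤ beta3HiQ u`. [folklore] -/
theorem le_beta3HiQ (u : ℚ) :
    2 * Real.log 3 / Real.sqrt 3 * Real.sin ((u : ℝ) * Real.log 3) ≤ (beta3HiQ u : ℝ) := by
  have h := (FI.mem_cosSin (mem_theta3FI u)).2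
  exact FI.le_hiQ (FI.mem_mul mem_cThreeFI h)

/-! ## The signed prime-3 test and the two-prime cell checker -/

namespace TPDCell

/-- The claimed constants `a3lo ≤ s·α₃(u)`, `b3lo ≤ s·β₃(u)` checked against the engine for the sign `s`:
`s = 1`: `a3lo ≤ alpha3LoQ u`, `b3lo ≤ beta3LoQ u`; `s = −1`: `a3lo ≤ −alpha3HiQ u`, `b3lo ≤ −beta3HiQ u`;
`s = 0`: `a3lo ≤ 0`, `b3lo ≤ 0`; any other `s` is refused. [folklore] -/
def checkRipple3S (s : ℤ) (c : TPDCell) : Bool :=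
  if s = 1 then decide (c.a3lo ≤ alpha3LoQ c.fp.psi.u) && decide (c.b3lo ≤ beta3LoQ c.fp.psi.u)
  else if s = -1 then decide (c.a3lo ≤ -alpha3HiQ c.fp.psi.u) && decide (c.b3lo ≤ -beta3HiQ c.fp.psi.u)
  else if s = 0 then decide (c.a3lo ≤ 0) && decide (c.b3lo ≤ 0)
  else false

/-- Soundness of the signed prime-3 test: `a3lo ≤ s·α₃(u)` and `b3lo ≤ s·β₃(u)`. [folklore] -/
theorem checkRipple3S_spec {s : ℤ} {c : TPDCell} (h : checkRipple3S s c = true) :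
    (c.a3lo : ℝ) ≤ (s : ℝ) * -(2 * Real.log 3 / Real.sqrt 3 * Real.cos ((c.fp.psi.u : ℝ) * Real.log 3)) ∧
      (c.b3lo : ℝ) ≤ (s : ℝ) * (2 * Real.log 3 / Real.sqrt 3 * Real.sin ((c.fp.psi.u : ℝ) * Real.log 3)) := by
  unfold checkRipple3S at h
  by_cases h1 : s = 1
  · rw [if_pos h1] at h
    simp only [Bool.and_eq_true, decide_eq_true_eq] at h
    subst h1
    push_cast
    rw [one_mul, one_mul]
    exact ⟨le_trans (by exact_mod_cast h.1) (alpha3LoQ_le c.fp.psi.u),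
      le_trans (by exact_mod_cast h.2) (beta3LoQ_le c.fp.psi.u)⟩
  · rw [if_neg h1] at h
    by_cases h2 : s = -1
    · rw [if_pos h2] at h
      simp only [Bool.and_eq_true, decide_eq_true_eq] at h
      subst h2
      push_cast
      rw [neg_one_mul, neg_one_mul]
      have ha : ((c.a3lo : ℚ) : ℝ) ≤ -((alpha3HiQ c.fp.psi.u : ℚ) : ℝ) := by exact_mod_cast h.1
      have hb : ((c.b3lo : ℚ) : ℝ) ≤ -((beta3HiQ c.fp.psi.u : ℚ) : ℝ) := by exact_mod_cast h.2
      exact ⟨ha.trans (neg_le_neg (le_alpha3HiQ c.fp.psi.u)), hb.trans (neg_le_neg (le_beta3HiQ c.fp.psi.u))⟩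
    · rw [if_neg h2] at h
      by_cases h3 : s = 0
      · rw [if_pos h3] at h
        simp only [Bool.and_eq_true, decide_eq_true_eq] at h
        subst h3
        push_cast
        rw [zero_mul, zero_mul]
        exact ⟨by exact_mod_cast h.1, by exact_mod_cast h.2⟩
      · rw [if_neg h3] at h
        exact absurd h Bool.false_ne_true

/-- All checks of a twisted two-prime cell, integer form: the first-prime part by the twisted checker
`FPDCell.checkZS s₂ p j`, then `n3 ≥ 1`, `0 ≤ L3lo`, `(v − u)·L3hi ≤ 1`, the `log 3` enclosure, and the signed
prime-`3` test `checkRipple3S s₃`. [folklore] -/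
def checkZS23 (s₂ s₃ : ℤ) (p j : ℕ) (c : TPDCell) : Bool :=
  FPDCell.checkZS s₂ p j c.fp && decide (0 < c.n3) && decide (0 ≤ c.L3lo) &&
    decide ((c.fp.psi.v - c.fp.psi.u) * c.L3hi ≤ 1) &&
    decide (c.L3lo ≤ logThreeLoQ') && decide (logThreeHiQ' ≤ c.L3hi) && checkRipple3S s₃ c

variable {s₂ s₃ : ℤ} {p j : ℕ} {c : TPDCell}

/-- Unpacking `checkZS23`. [folklore] -/
theorem checkZS23_spec (h : checkZS23 s₂ s₃ p j c = true) :
    FPDCell.checkZS s₂ p j c.fp = true ∧ 0 < c.n3 ∧ 0 ≤ c.L3lo ∧ (c.fp.psi.v - c.fp.psi.u) * c.L3hi ≤ 1 ∧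
      c.L3lo ≤ logThreeLoQ' ∧ logThreeHiQ' ≤ c.L3hi ∧ checkRipple3S s₃ c = true := by
  simp only [checkZS23, Bool.and_eq_true, decide_eq_true_eq] at h
  exact ⟨h.1.1.1.1.1.1, h.1.1.1.1.1.2, h.1.1.1.1.2, h.1.1.1.2, h.1.1.2, h.1.2, h.2⟩

/-- `0 ≤ u` for a `ZS23`-checked cell. [folklore] -/
theorem u_nonneg_ZS23 (h : checkZS23 s₂ s₃ p j c = true) : 0 ≤ c.fp.psi.u :=
  WeilCell.u_nonneg_Z (FPDCell.checkZS_spec (checkZS23_spec h).1).1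

/-- `u < v` for a `ZS23`-checked cell. [folklore] -/
theorem u_lt_v_ZS23 (h : checkZS23 s₂ s₃ p j c = true) : c.fp.psi.u < c.fp.psi.v :=
  WeilCell.u_lt_v_Z (FPDCell.checkZS_spec (checkZS23_spec h).1).1

/-- **Signed prime-3 ripple soundness.** On the cell, `P₃(t − u) ≤ s · (−(2 log 3/√3) cos(t log 3))`
(addition formula at `u`, signed Maclaurin brackets of `cos(hL₃)`, `sin(hL₃)` on `0 ≤ hL₃ ≤ 1`). [folklore] -/
theorem polyR_cosPart3_le_signed {s : ℤ} (hn : 0 < c.n3) (hL0q : 0 ≤ c.L3lo)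
    (hwq : (c.fp.psi.v - c.fp.psi.u) * c.L3hi ≤ 1) (hLloq : c.L3lo ≤ logThreeLoQ') (hLhiq : logThreeHiQ' ≤ c.L3hi)
    (ha : (c.a3lo : ℝ) ≤ (s : ℝ) * -(2 * Real.log 3 / Real.sqrt 3 * Real.cos ((c.fp.psi.u : ℝ) * Real.log 3)))
    (hb : (c.b3lo : ℝ) ≤ (s : ℝ) * (2 * Real.log 3 / Real.sqrt 3 * Real.sin ((c.fp.psi.u : ℝ) * Real.log 3)))
    {t : ℝ} (hut : (c.fp.psi.u : ℝ) ≤ t) (htv : t ≤ (c.fp.psi.v : ℝ)) :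
    polyR c.cosPart3 (t - c.fp.psi.u) ≤ (s : ℝ) * -(2 * Real.log 3 / Real.sqrt 3 * Real.cos (t * Real.log 3)) := by
  set L : ℝ := Real.log 3 with hLdef
  set u : ℝ := (c.fp.psi.u : ℝ) with hudef
  set hh : ℝ := t - u with hhdef
  have hL0 : (0 : ℝ) ≤ c.L3lo := by exact_mod_cast hL0q
  have hL1 : (c.L3lo : ℝ) ≤ L := le_trans (by exact_mod_cast hLloq) logThree_mem_Q.1
  have hL2 : L ≤ (c.L3hi : ℝ) := le_trans logThree_mem_Q.2 (by exact_mod_cast hLhiq)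
  have hLnn : 0 ≤ L := hL0.trans hL1
  have hh0 : 0 ≤ hh := by rw [hhdef]; linarith
  have hhw : hh ≤ (c.fp.psi.v : ℝ) - c.fp.psi.u := by rw [hhdef, hudef]; linarith
  have hhL : hh * L ≤ 1 := by
    have h1 : hh * L ≤ ((c.fp.psi.v : ℝ) - c.fp.psi.u) * c.L3hi :=
      mul_le_mul hhw hL2 hLnn (by linarith)
    have h2 : ((c.fp.psi.v : ℝ) - c.fp.psi.u) * c.L3hi ≤ 1 := by exact_mod_cast hwq
    linarith
  have hy0 : 0 ≤ hh * L := mul_nonneg hh0 hLnn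
  have hcos0 : 0 ≤ Real.cos (hh * L) :=
    Real.cos_nonneg_of_mem_Icc ⟨by linarith [Real.pi_pos], by linarith [Real.pi_gt_three]⟩
  have hsin0 : 0 ≤ Real.sin (hh * L) :=
    Real.sin_nonneg_of_nonneg_of_le_pi hy0 (by linarith [Real.pi_gt_three])
  -- addition formula at the left end point, scaled by `s`
  set α : ℝ := (s : ℝ) * -(2 * Real.log 3 / Real.sqrt 3 * Real.cos (u * L)) with hαdef
  set β : ℝ := (s : ℝ) * (2 * Real.log 3 / Real.sqrt 3 * Real.sin (u * L)) with hβdef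
  have hadd : (s : ℝ) * -(2 * Real.log 3 / Real.sqrt 3 * Real.cos (t * Real.log 3)) =
      α * Real.cos (hh * L) + β * Real.sin (hh * L) := by
    have : t * Real.log 3 = u * L + hh * L := by rw [hhdef, hLdef]; ring
    rw [this, Real.cos_add, hαdef, hβdef]
    ring
  have ha' : (c.a3lo : ℝ) ≤ α := by rw [hαdef, hudef, hLdef]; exact ha
  have hb' : (c.b3lo : ℝ) ≤ β := by rw [hβdef, hudef, hLdef]; exact hb
  rw [hadd, TPDCell.polyR_cosPart3]
  refine add_le_add ?_ ?_
  · unfold TPDCell.cosBracket3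
    split_ifs with hsgn
    · have h0 : (0 : ℝ) ≤ c.a3lo := by exact_mod_cast hsgn
      calc (c.a3lo : ℝ) * polyR (cosLoCoeffs c.L3lo c.L3hi c.n3) hh
          ≤ (c.a3lo : ℝ) * Real.cos (hh * L) :=
            mul_le_mul_of_nonneg_left (polyR_cosLo_le hL0 hL1 hL2 hh0 hhL hn) h0
        _ ≤ α * Real.cos (hh * L) := mul_le_mul_of_nonneg_right ha' hcos0
    · push Not at hsgn
      have h0 : (c.a3lo : ℝ) ≤ 0 := by exact_mod_cast hsgn.le
      calc (c.a3lo : ℝ) * polyR (cosUpCoeffs c.L3lo c.L3hi c.n3) hh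
          ≤ (c.a3lo : ℝ) * Real.cos (hh * L) :=
            mul_le_mul_of_nonpos_left (cos_le_polyR_cosUp hL0 hL1 hL2 hh0 hhL hn) h0
        _ ≤ α * Real.cos (hh * L) := mul_le_mul_of_nonneg_right ha' hcos0
  · unfold TPDCell.sinBracket3
    split_ifs with hsgn
    · have h0 : (0 : ℝ) ≤ c.b3lo := by exact_mod_cast hsgn
      calc (c.b3lo : ℝ) * polyR (sinLoCoeffs c.L3lo c.L3hi c.n3) hh
          ≤ (c.b3lo : ℝ) * Real.sin (hh * L) :=
            mul_le_mul_of_nonneg_left (polyR_sinLo_le hL0 hL1 hL2 hh0 hhL hn) h0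
        _ ≤ β * Real.sin (hh * L) := mul_le_mul_of_nonneg_right hb' hsin0
    · push Not at hsgn
      have h0 : (c.b3lo : ℝ) ≤ 0 := by exact_mod_cast hsgn.le
      calc (c.b3lo : ℝ) * polyR (sinUpCoeffs c.L3lo c.L3hi c.n3) hh
          ≤ (c.b3lo : ℝ) * Real.sin (hh * L) :=
            mul_le_mul_of_nonpos_left (sin_le_polyR_sinUp hL0 hL1 hL2 hh0 hhL hn) h0
        _ ≤ β * Real.sin (hh * L) := mul_le_mul_of_nonneg_right hb' hsin0

/-- **Cell soundness (twisted two-prime integer checker).** On its cell, `σ(t) ≤ twistWeight23 s₂ s₃ t`. [folklore] -/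
theorem sigma_le_ZS23 (h : checkZS23 s₂ s₃ p j c = true) {t : ℝ} (hut : (c.fp.psi.u : ℝ) ≤ t)
    (htv : t ≤ (c.fp.psi.v : ℝ)) : c.sigma t ≤ twistWeight23 s₂ s₃ t := by
  obtain ⟨hfp, hn, hL0q, hwq, hLloq, hLhiq, hrip⟩ := checkZS23_spec h
  obtain ⟨ha, hb⟩ := checkRipple3S_spec hrip
  have h1 := FPDCell.sigma_le_ZS hfp hut htv
  have h2 := polyR_cosPart3_le_signed hn hL0q hwq hLloq hLhiq ha hb hut htv
  unfold TPDCell.sigma twistWeight23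
  linarith

end TPDCell

/-! ## Weight-generic validity of a two-prime cell -/

/-- What a weight-generic chain layer uses about a two-prime cell for a weight `W`: `0 ≤ u < v`, `σ ≤ W` on the
cell, the signed bound `|wL − σ| ≤ bndQ wL` on the cell, and `0 ≤ bndQ` (the analogue of `TPDCell.Valid` with
`w₂₃` replaced by `W`, and of `CellValidW` for two-prime cells). [folklore] -/
structure CellValidW23 (c : TPDCell) (W : ℝ → ℝ) : Prop where
  /-- `0 ≤ u` -/
  u_nonneg : 0 ≤ c.fp.psi.u
  /-- `u < v` -/
  u_lt_v : c.fp.psi.u < c.fp.psi.v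
  /-- `σ ≤ W` on the cell -/
  sigma_le : ∀ {t : ℝ}, (c.fp.psi.u : ℝ) ≤ t → t ≤ (c.fp.psi.v : ℝ) → c.sigma t ≤ W t
  /-- `|wL − σ| ≤ bndQ wL` on the cell -/
  abs_sub_le : ∀ (wL : ℚ) {t : ℝ}, (c.fp.psi.u : ℝ) ≤ t → t ≤ (c.fp.psi.v : ℝ) →
    |(wL : ℝ) - c.sigma t| ≤ c.bndQ wL
  /-- `0 ≤ bndQ wL` -/
  bndQ_nonneg : ∀ wL : ℚ, 0 ≤ c.bndQ wL

/-- A cell accepted by `checkZS23 s₂ s₃ p j` is a valid minorant cell of `twistWeight23 s₂ s₃`. [folklore] -/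
theorem cellValidW23_of_checkZS23 {s₂ s₃ : ℤ} {p j : ℕ} {c : TPDCell} (h : TPDCell.checkZS23 s₂ s₃ p j c = true) :
    CellValidW23 c (twistWeight23 s₂ s₃) :=
  ⟨TPDCell.u_nonneg_ZS23 h, TPDCell.u_lt_v_ZS23 h, fun hut htv ↦ TPDCell.sigma_le_ZS23 h hut htv,
    fun wL _t hut htv ↦ TPDCell.abs_level_sub_sigma_le_of (TPDCell.u_nonneg_ZS23 h) wL hut htv,
    fun wL ↦ TPDCell.bndQ_nonneg_of (TPDCell.u_nonneg_ZS23 h) (TPDCell.u_lt_v_ZS23 h) wL⟩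

/-- The `ζ` weight is the case `s₂ = s₃ = 1`: a `CellValidW23`-cell for `twistWeight23 1 1` is `TPDCell.Valid`
(so the `ζ` chain layer applies to it). [folklore] -/
theorem valid_of_cellValidW23_one_one {c : TPDCell} (h : CellValidW23 c (twistWeight23 1 1)) : c.Valid := by
  refine ⟨h.u_nonneg, h.u_lt_v, fun t hut htv ↦ ?_, fun wL t hut htv ↦ h.abs_sub_le wL hut htv, h.bndQ_nonneg⟩
  have := h.sigma_le hut htv
  unfold twistWeight23 twistWeight at this
  unfold weilTwoPrimeWeight
  push_cast at this
  linarith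

/-! ## The chain checker -/

/-- The rational `|s₂|·(√2 log 2)⁺ + |s₃|·(2 log 3/√3)⁺` charged to the tail level. [folklore] -/
def rippleHiQ23 (s₂ s₃ : ℤ) : ℚ := rippleHiQ s₂ + (if s₃ = 0 then 0 else cThreeFI.hiQ)

/-- `|s₂| √2 log 2 + |s₃| (2 log 3/√3) ≤ rippleHiQ23 s₂ s₃` for `|s₂|, |s₃| ≤ 1`. [folklore] -/
theorem abs_ripples_le_rippleHiQ23 {s₂ s₃ : ℤ} (h2 : |s₂| ≤ 1) (h3 : |s₃| ≤ 1) :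
    |(s₂ : ℝ)| * (Real.sqrt 2 * Real.log 2) + |(s₃ : ℝ)| * (2 * Real.log 3 / Real.sqrt 3) ≤
      (rippleHiQ23 s₂ s₃ : ℝ) := by
  have hA := abs_mul_cZero_le_rippleHiQ h2
  have hc : 2 * Real.log 3 / Real.sqrt 3 ≤ (cThreeFI.hiQ : ℝ) := FI.le_hiQ mem_cThreeFI
  have hc0 := cThree_nonneg
  unfold rippleHiQ23
  push_cast
  by_cases h0 : s₃ = 0
  · rw [if_pos h0, h0]; push_cast; rw [abs_zero, zero_mul]; linarith
  · rw [if_neg h0]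
    have h1 : |(s₃ : ℝ)| ≤ 1 := by exact_mod_cast h3
    have : |(s₃ : ℝ)| * (2 * Real.log 3 / Real.sqrt 3) ≤ (cThreeFI.hiQ : ℝ) :=
      calc |(s₃ : ℝ)| * (2 * Real.log 3 / Real.sqrt 3) ≤ 1 * (2 * Real.log 3 / Real.sqrt 3) :=
            mul_le_mul_of_nonneg_right h1 hc0
        _ ≤ (cThreeFI.hiQ : ℝ) := by rw [one_mul]; exact hc
    linarith

/-- **The integer checker of a twisted two-prime chain**: chain from `0` to `T` (`checkChain₂` on the first-prime
parts), every cell `checkZS23 s₂ s₃ p j`, `|s₂|, |s₃| ≤ 1`, `T` dyadic, and the tail level test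
`wL + rippleHiQ23 s₂ s₃ ≤ wLoZ(T)`. [folklore] -/
def checkCellsZS23 (s₂ s₃ : ℤ) (p j : ℕ) (wL T : ℚ) (M : ℕ) (cells : List TPDCell) : Bool :=
  checkChain₂ (cells.map TPDCell.fp) 0 T && cells.all (fun c ↦ TPDCell.checkZS23 s₂ s₃ p j c) &&
    decide (|s₂| ≤ 1) && decide (|s₃| ≤ 1) &&
    decide (1 ≤ j) && decide (T * 2 ^ j = ((dyNum T j : ℕ) : ℚ)) &&
    decide (wL + rippleHiQ23 s₂ s₃ ≤ wLoZ p (dyNum T j) j M)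

/-- Unpacking `checkCellsZS23`. [folklore] -/
theorem checkCellsZS23_spec {s₂ s₃ : ℤ} {p j : ℕ} {wL T : ℚ} {M : ℕ} {cells : List TPDCell}
    (h : checkCellsZS23 s₂ s₃ p j wL T M cells = true) :
    checkChain₂ (cells.map TPDCell.fp) 0 T = true ∧ (∀ c ∈ cells, TPDCell.checkZS23 s₂ s₃ p j c = true) ∧
      |s₂| ≤ 1 ∧ |s₃| ≤ 1 ∧ 1 ≤ j ∧ T * 2 ^ j = ((dyNum T j : ℕ) : ℚ) ∧
      wL + rippleHiQ23 s₂ s₃ ≤ wLoZ p (dyNum T j) j M := by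
  simp only [checkCellsZS23, Bool.and_eq_true, List.all_eq_true, decide_eq_true_eq] at h
  exact ⟨h.1.1.1.1.1.1, h.1.1.1.1.1.2, h.1.1.1.1.2, h.1.1.1.2, h.1.1.2, h.1.2, h.2⟩

/-- **The tail consequence of the checker**: if `checkCellsZS23 … = true` and `0 ≤ T`, then
`wL ≤ twistWeight23 s₂ s₃ τ` for every `|τ| ≥ T`. [folklore] -/
theorem checkCellsZS23_tail {s₂ s₃ : ℤ} {p j : ℕ} {wL T : ℚ} {M : ℕ} {cells : List TPDCell}
    (h : checkCellsZS23 s₂ s₃ p j wL T M cells = true) (hT0 : (0 : ℚ) ≤ T) {τ : ℝ} (hτ : (T : ℝ) ≤ |τ|) :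
    ((wL : ℚ) : ℝ) ≤ twistWeight23 s₂ s₃ τ := by
  obtain ⟨-, -, hs2, hs3, hj, hT, hwL⟩ := checkCellsZS23_spec h
  have hlev := wLoZ_le p (dyNum T j) hj M
  have hTe : ((dyNum T j : ℕ) : ℝ) / 2 ^ j = (T : ℝ) := by
    have : (T : ℝ) * 2 ^ j = ((dyNum T j : ℕ) : ℝ) := by exact_mod_cast hT
    rw [← this, mul_div_assoc, div_self (by positivity), mul_one]
  rw [hTe] at hlev
  have hwL' : ((wL : ℚ) : ℝ) + (rippleHiQ23 s₂ s₃ : ℝ) ≤ (wLoZ p (dyNum T j) j M : ℝ) := by exact_mod_cast hwL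
  have htail := twistWeight23_ge_tail (s₂ := s₂) (s₃ := s₃) (by exact_mod_cast hT0 : (0 : ℝ) ≤ T) hτ
  have hrip := abs_ripples_le_rippleHiQ23 hs2 hs3
  linarith

/-! ## Comparison with the true weights of the two parities -/

/-- For either parity `a ≤ 1`:
`twistWeight23 s₂ s₃ τ ≤ Re ψ(1/4 + a/2 + iτ/2) + s₂·(−√2 log 2 cos(τ log 2)) + s₃·(−(2 log 3/√3) cos(τ log 3))`
(the parity bonus is dropped). [folklore] -/
theorem twistWeight23_le_parity (s₂ s₃ : ℤ) {a : ℕ} (ha : a ≤ 1) (τ : ℝ) :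
    twistWeight23 s₂ s₃ τ ≤ (Complex.digamma (1 / 4 + (a : ℂ) / 2 + τ / 2 * I)).re +
      (s₂ : ℝ) * (-(Real.sqrt 2 * Real.log 2 * Real.cos (τ * Real.log 2))) +
      (s₃ : ℝ) * (-(2 * Real.log 3 / Real.sqrt 3 * Real.cos (τ * Real.log 3))) := by
  have h := twistWeight_le_parity s₂ ha τ
  unfold twistWeight23
  linarith

end Summit.Ventures.WeilGRH

end
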